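import Summits.Ventures.Crystal3D.Theorems.StickyWulffConstantGenericWallFloorBarlowPrefix
import HarnessLib

/-!
# Canonical start states on a Barlow plate are VALID and CERTIFIED (the `hvalid` / `h0` inputs of F4, by name)
# (crux `GenericWallFloor`, stmt-Ventures-19480, line `WallLedgerG`; G-side half of lane T's F4, cf-p1 §86(58) BA)

HONEST FRAMING. Venture `Summits/Ventures/Crystal3D` (cell `crystal3d-full`), helper `--supports` the crux `GenericWallFloor`
(stmt-Ventures-19480) of `route-Ventures-StickyWulffConstant`, registered line `WallLedgerG`, open stub `stub_twoSlabAdhesion`.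
Rung credit only; F-C1 not moved; NOT the stub.

In the conventions of `…BarlowPrefix` (canonical states `canon`, model steps `ms`, given by their defining equations): if the
predecessor site `p′ = barlowPos σ k i j` has its whole dozen in `X` after the motion and the family slot `v₀` is steep for `z`,
then the canonical state at the start ball `t = L (p′ + ms k) + s₀` (layer `k + 1`) is

* valid — `WalkInv X z` and `StackWF z` (`walkInv_capStart_barlow` over a Δ-bilayer, `walkInv_capStart₂_barlow` over ∇), and
* certified — `∃ e rest, stack = e :: rest ∧ WalkCertified12 X t e` (the four certificates `walkCertified12_capStart(₂)_barlow_cc/_hc`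
  according to the classes of the two bilayers below `t`),
packaged as **`canon_start_valid`**: exactly the hypotheses `hvalid` of `windowFamily_walkRun_injOn` / `canon_walkRun_injOn`
(`…BarlowWindowFamily`, `…BarlowOrbitFree`) and `h0` of `walkRun_certified12`, so that F4 obtains validity, certification and
end-injectivity of a window family from ONE plate hypothesis per start (complete predecessor dozen) plus steepness of `v₀`.
WHAT THIS IS NOT: no count, no sealing, no payer sum; F-C1 not moved.
-/

noncomputable section

namespace Summit.Ventures.Crystal3D.Theorems

open Finset
open Literature.MathematicalPhysics.StatisticalMechanics
open scoped InnerProductSpace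

variable {X : Finset (EuclideanSpace ℝ (Fin 3))}

section Moved

variable (σ : ℤ → ℤ) (L : EuclideanSpace ℝ (Fin 3) ≃ₗᵢ[ℝ] EuclideanSpace ℝ (Fin 3)) (s₀ z v₀ : EuclideanSpace ℝ (Fin 3))
  (canon : ℤ → EuclideanSpace ℝ (Fin 3) → EuclideanSpace ℝ (Fin 3) × List WalkEntry) (ms : ℤ → EuclideanSpace ℝ (Fin 3))

/-- **Canonical start states are valid and certified.**  See the module docstring. -/
theorem canon_start_valid (hσ : IsHaggSeq σ) (hz : ‖z‖ = 1) (hv₀ : v₀ ∈ fccSlots) (hv₀2 : v₀ 2 = Real.sqrt (2 / 3))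
    (hsteep : Real.sqrt 2 / 2 ≤ ⟪L v₀, z⟫_ℝ)
    (hcanon₁ : ∀ m t, σ (m - 1) = 1 → canon m t = (t, [⟨L, v₀, 0⟩]))
    (hcanon₂ : ∀ m t, σ (m - 1) = -1 → canon m t =
      (t, [⟨twinFrame L (L (EuclideanSpace.single (2 : Fin 3) (1 : ℝ))),
            bestCapper (twinFrame L (L (EuclideanSpace.single (2 : Fin 3) (1 : ℝ)))) (L (EuclideanSpace.single (2 : Fin 3) (1 : ℝ))) z,
            L (EuclideanSpace.single (2 : Fin 3) (1 : ℝ))⟩, ⟨L, v₀, 0⟩]))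
    (hms₁ : ∀ m, σ m = 1 → ms m = v₀)
    (hms₂ : ∀ m, σ m = -1 → ms m =
      basalMirror (bestCapper (twinFrame L (L (EuclideanSpace.single (2 : Fin 3) (1 : ℝ)))) (L (EuclideanSpace.single (2 : Fin 3) (1 : ℝ))) z))
    {k i j : ℤ}
    (hX : ∀ q ∈ barlowStacking 1 (Real.sqrt (2 / 3)) σ, dist q (barlowPos 1 (Real.sqrt (2 / 3)) σ k i j) ≤ 1 → L q + s₀ ∈ X) :
    WalkInv X z (canon (k + 1) (L (barlowPos 1 (Real.sqrt (2 / 3)) σ k i j + ms k) + s₀)) ∧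
      StackWF z (canon (k + 1) (L (barlowPos 1 (Real.sqrt (2 / 3)) σ k i j + ms k) + s₀)).2 ∧
      ∃ e rest, (canon (k + 1) (L (barlowPos 1 (Real.sqrt (2 / 3)) σ k i j + ms k) + s₀)).2 = e :: rest ∧
        WalkCertified12 X (canon (k + 1) (L (barlowPos 1 (Real.sqrt (2 / 3)) σ k i j + ms k) + s₀)).1 e := by
  set e₃ : EuclideanSpace ℝ (Fin 3) := EuclideanSpace.single (2 : Fin 3) (1 : ℝ) with he₃
  set G := twinFrame L (L e₃) with hG
  set q := bestCapper G (L e₃) z with hqdef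
  obtain ⟨hq, hq2⟩ : q ∈ fccSlots ∧ q 2 = -Real.sqrt (2 / 3) := bestCapper_nabla_slot L z
  have hrpos : 0 < Real.sqrt (2 / 3) := Real.sqrt_pos.2 (by norm_num)
  set p₀ := barlowPos 1 (Real.sqrt (2 / 3)) σ k i j with hp₀
  have hk1 : k + 1 - 1 = k := by ring
  rcases hσ k with hk | hk
  · -- Δ-bilayer below the start: 1-level state
    have ht : canon (k + 1) (L (p₀ + ms k) + s₀) = (L p₀ + s₀ + L v₀, [⟨L, v₀, 0⟩]) := by
      rw [hcanon₁ (k + 1) _ (by rw [hk1]; exact hk), hms₁ k hk, map_add]; congr 1; abel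
    rw [ht]
    refine ⟨walkInv_capStart_barlow σ L s₀ k i j hk hX hv₀ hv₀2 hsteep, stackWF_start z L v₀, ⟨L, v₀, 0⟩, [], rfl, ?_⟩
    rcases hσ (k - 1) with hk' | hk'
    · exact walkCertified12_capStart_barlow_cc σ L s₀ k i j hk hk' hX
    · exact walkCertified12_capStart_barlow_hc σ L s₀ k i j hk hk' hX hv₀2
  · -- ∇-bilayer below the start: 2-level state
    have hGq : G q = L (basalMirror q) := by rw [hG, twinFrame_axis_apply]
    have ht : canon (k + 1) (L (p₀ + ms k) + s₀) = (L p₀ + s₀ + G q, [⟨G, q, L e₃⟩, ⟨L, v₀, 0⟩]) := by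
      rw [hcanon₂ (k + 1) _ (by rw [hk1]; exact hk), hms₂ k hk, map_add, ← hGq]; congr 1; abel
    rw [ht]
    obtain ⟨hI, hW⟩ := walkInv_capStart₂_barlow σ L s₀ k i j hz hk hX hv₀ hv₀2 hsteep
    refine ⟨hI, hW, ⟨G, q, L e₃⟩, [⟨L, v₀, 0⟩], rfl, ?_⟩
    rcases hσ (k - 1) with hk' | hk'
    · have hqpos : 0 < ⟪G q, L e₃⟫_ℝ := by
        rw [hGq, inner_frame_axis, basalMirror_apply_coord]
        simp only [if_true, hq2, neg_neg]
        exact hrpos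
      exact walkCertified12_capStart₂_barlow_hc σ L s₀ k i j hk hk' hX hqpos
    · exact walkCertified12_capStart₂_barlow_cc σ L s₀ k i j hk hk' hX

end Moved

end Summit.Ventures.Crystal3D.Theorems

end
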